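import Literature.MathematicalPhysics.QuantumFieldTheory.Balaban1983to89.T4DatumAssembly
import Literature.MathematicalPhysics.QuantumFieldTheory.Balaban1983to89.Node00.Carriers3Leaf

/-!
# NODE 00 (YM-PLAN Track A) — STAGE 5 OF THE RECORD CHAIN: the RECORD PREDICATE `IsRecordOfRecord₅ F N D w`
# («(D, w) are Bałaban's finite-ε datum of record over the four-torus family `F` and its binding world of record»)
# at the ASSEMBLER STAGE — the datum is ASSEMBLED (`T4DatumAssembly.datumOfRecord`) from an RG machine built on the
# Stage-5 parameters, the world carries the Stage-3 carriers of record, the assembled construction, the interval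
# constant and the block size; every object of Bałaban's NOT YET typed from print is a NAMED FIELD of `Residual₅`

NODE 00 STAGE-5 MODULE (seat `pub-ymgap-node00-def` g28, 2026-08-26; definition item `defn-IsRecordOfRecord₅` of route
«BalabanUVNodes» (R422 «DEFINITION FIRST»); design note `HOME/pub-ymgap-node00-def/STAGE5-SCOPING-g28.md`; the CONVENTIONS OF RECORD
block of the root module `Node00.Carriers` applies).  APPEND-ONLY GROWTH: a NEW importing module; no landed module edited.

WHAT IS PINNED HERE (by equations, as functions of the parameters `θ : Stage5Params F N`):
* the WORLD: `w.up P = Upstream.ofPrintedAllXPN (carriers₃ θ (X P)) (Y P) (Z P) (V P) (W P)` (Stages 1–3: the B4 ∕ B5 ∕ B7 groups and the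
  k-level B6 block of record), `w.C = D.C` (THE construction of the datum), `w.γ = θ.γ > 0` (the interval constant), `w.L = θ.L` (Bałaban's block
  size); the remaining scalar fields of `w` (`em, ep` = the (2.50) exponents E₋(g_k), E₊(g_k) of [Balaban1988Convergent] Cor. 3; `βup, β₀, b` =
  the β-bounds β⁺ of [Balaban1987RG1] (1.22), (2.6) and the unprinted lower bound; `gR` = the renormalised coupling of Thm 2) are constants
  print asserts to EXIST and defines by no equation — they stay fields of `w` (a child statement reading them must quantify them);
* the DATUM: `D = T4DatumAssembly.datumOfRecord F N (machineOfRecord₅ θ)` — averaging := Bałaban's block averaging of record (Stage 0,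
  `Node00.avOfRecord`, (0.3)–(0.4) [Balaban1987RG1] p. 253), flow := generated FORWARD by (0.18)∕(0.20) from the bare coupling with the
  machine's β-functions, `ρ₀ = e^{−E}·exp(−A/g₀²)`, `ρ_{k+1} = R_k(T_k ρ_k)` ([Balaban1988Convergent] (0.2) p. 244) with `T_k` the Radon–Nikodym
  transport of the averaging of record, `curries`∕`fwd`∕`Realisation` PROVED by the assembler (seat dag-n23-a);
* the §2-FORM CLAUSE of the construction reads the DENSITIES: `Sect2Form p k := θ.res.S218 p k (ρ_k)` — a predicate ON the determined density,
  never a free truth value; likewise `Repr`∕`IndAss` read the step's action data through `θ.res.ReprA`∕`IndA`.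

WHAT IS RESIDUAL (the record `Residual₅ F N` — Bałaban's objects the tree does not yet define FROM PRINT; each field's docstring names the
printed equations that define it; later NODE 00 stages replace fields by definitions in NEW modules with refining predicates
`IsRecordOfRecord₆ → IsRecordOfRecord₅ …`, never editing this one): the run-indexed carrier families of the [B8]–[B16] groups (`X`'s B8 ∕ B10 ∕
B12 ∕ B13 data, `Y`, `Z`, `V`, `W`), the β-functions ((1.20)–(1.22) [Balaban1987RG1]: second moments of the vacuum-polarisation kernel of the
effective action — `B12Beta`), the normalisation `E` ((1.15) [III]), the small-field domains, effective actions, background Wilson actions,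
expansion terms and characteristic functions ((2.10)–(2.17) [III], (0.22)–(0.23) [I]), the format predicates `S218` ((2.18) with (2.23)–(2.44)
[III] — `B14Eq218Concrete` is the typed neighbour), `ReprA` ((0.22)–(0.24), (0.29) [I] — `B12.Repr022`), `IndA` ((1.1)–(1.22) [I] — `Step`), and the
large-field operation `R` ((0.2)–(0.6) [Balaban1989LargeFieldI] p. 176) WITH its two printed properties (0.4) `∫Rρ = ∫ρ` and preservation of
integrability, which `T4Continuum.Realisation` demands of any datum.  A child statement that READS a residual field is refutable by a junk
value of that field until the field's stage lands (the per-child table of the design note); children reading only pinned fields (N01, N02,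
N04, N23; N03 modulo the Prop. 2.6 census; W00's binding half) are theorems here.

HONEST FRAMING: definitions + kernel bookkeeping; NO estimate, NO satisfiability claim (existence of the record on every family is the route's
`stub_W00`); nothing of Bałaban's asserted; one finite T⁴ programme at fixed ε per run — NOT ℝ⁴ ∕ infinite volume ∕ OS ∕ mass gap ∕ Clay.
-/

noncomputable section

open MeasureTheory

namespace Literature.MathematicalPhysics.QuantumFieldTheory.Balaban1983to89.Node00

open T4Continuum AveragingRT T4FiniteEpsInhabited FlowStep FlowStepRuns DagBinding T4DatumAssembly
open B6KLevelCensusIndexV1 (KIdx kGeoG)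
open B6Prop26Census2136KLevelV1 (kG)

variable (F : T4Family) (N : ℕ) [NeZero N]

/-! ## §1. The residual objects and the Stage-5 parameters -/

/-- **RESIDUAL OBJECTS of the Stage-5 record** over the family `F` at `SU(N)` — DATA, asserting nothing: (R1) the run-indexed carrier families of
the groups not pinned by Stages 1–3 (`X P`'s B8 ∕ B10 ∕ B12 ∕ B13 data — its B4 ∕ B5 ∕ B6 ∕ B7 groups are OVERWRITTEN by `carriers₃` —, `Y P` [B9],
`Z P` [B11], `V P` [B14]'s 𝐑-carrier, `W P` [B15]); (R2) the RG machine's objects — β-functions, normalisation `E`, small-field domains, effective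
actions, background Wilson actions, expansion terms, characteristic functions, the three FORMAT PREDICATES (`S218` on densities; `ReprA`, `IndA` on
the step's history and action data) and Bałaban's `R` with (0.4) and integrability preservation.  Field ↦ defining display: `βfun` ↦
[Balaban1987RG1] (1.20)–(1.22) p. 264; `E` ↦ [Balaban1988Convergent] Thm 1 p. 262 with (1.15); `dom`, `χ` ↦ (2.16)–(2.17) p. 257; `effAction`,
`wilsonBG`, `Ek` ↦ [Balaban1987RG1] (0.22)–(0.23) p. 256; `S218` ↦ (2.18) p. 257 with (2.23)–(2.44); `ReprA` ↦ (0.22)–(0.24), (0.29) pp. 256–258;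
`IndA` ↦ (1.1)–(1.22) pp. 260–264; `R` ↦ [Balaban1989LargeFieldI] (0.2)–(0.6) pp. 176–177.
[cite: Balaban1988Convergent, (0.2) p.244; Balaban1989LargeFieldI, (0.2)–(0.6) pp.176–177; Balaban1987RG1, (0.22)–(0.24) p.256 and (1.20)–(1.22) p.264 (dictionary of the residual)] -/
structure Residual₅ where
  /-- run-indexed carrier bundle whose B8 ∕ B10 ∕ B12 ∕ B13 groups are read (B4 ∕ B5 ∕ B6 ∕ B7 overwritten by the Stage-3 objects) -/
  X : B12.RunParams → PrintedCarriersR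
  /-- run-indexed [Balaban1985BackgroundPropagators] carriers -/
  Y : B12.RunParams → PrintedCarriers9X
  /-- run-indexed [Balaban1985Variational] carriers -/
  Z : B12.RunParams → PrintedCarriers11
  /-- run-indexed 𝐑-carrier of [Balaban1988Convergent] -/
  V : B12.RunParams → PrintedCarriers14R
  /-- run-indexed [Balaban1989LargeFieldI] carriers -/
  W : B12.RunParams → PrintedCarriers15
  /-- the history-dependent β-functions `β_{k+1}(g_0, …, g_k)` -/
  βfun : HBeta
  /-- the normalisation constant `E` of `ρ₀ = exp[−(1/g₀²)A − E]`, per run -/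
  E : B12.RunParams → ℝ
  /-- the small-field domains -/
  dom : (p : B12.RunParams) → (k : ℕ) → Set (GaugeField (F.P p.K) k (SU N))
  /-- the effective actions `A_k(g_k, V)` -/
  effAction : (p : B12.RunParams) → (k : ℕ) → GaugeField (F.P p.K) k (SU N) → ℝ
  /-- the Wilson action of the background configuration `U_k(V)` -/
  wilsonBG : (p : B12.RunParams) → (k : ℕ) → GaugeField (F.P p.K) k (SU N) → ℝ
  /-- the expansion term `𝐄_k(U_k(V))` -/
  Ek : (p : B12.RunParams) → (k : ℕ) → GaugeField (F.P p.K) k (SU N) → ℝ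
  /-- the characteristic functions `χ_k` of (2.17) [III] -/
  χ : (p : B12.RunParams) → (k : ℕ) → GaugeField (F.P p.K) k (SU N) → ℝ
  /-- FORMAT PREDICATE «`ρ_k` has the form (2.18) with (2.23)–(2.44) [III]», on step-`k` densities -/
  S218 : (p : B12.RunParams) → (k : ℕ) → Density (F.P p.K) k (SU N) → Prop
  /-- FORMAT PREDICATE «`A_k` is given by (0.22)–(0.24) with (0.29) [I]», on (history, domain, action, background action, expansion term) -/
  ReprA : (p : B12.RunParams) → (k : ℕ) → (Fin (k + 1) → ℝ) → Set (GaugeField (F.P p.K) k (SU N)) →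
    (GaugeField (F.P p.K) k (SU N) → ℝ) → (GaugeField (F.P p.K) k (SU N) → ℝ) → (GaugeField (F.P p.K) k (SU N) → ℝ) → Prop
  /-- FORMAT PREDICATE «`A_k` satisfies the inductive assumptions (1.1)–(1.22) [I]», same arguments -/
  IndA : (p : B12.RunParams) → (k : ℕ) → (Fin (k + 1) → ℝ) → Set (GaugeField (F.P p.K) k (SU N)) →
    (GaugeField (F.P p.K) k (SU N) → ℝ) → (GaugeField (F.P p.K) k (SU N) → ℝ) → (GaugeField (F.P p.K) k (SU N) → ℝ) → Prop
  /-- Bałaban's large-field operation `R` after the `(k+1)`-st transformation -/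
  R : (p : B12.RunParams) → (k : ℕ) → Density (F.P p.K) (k + 1) (SU N) → Density (F.P p.K) (k + 1) (SU N)
  /-- (0.4) [IV]: `∫ dV (Rρ)(V) = ∫ dV ρ(V)`, `k < K` -/
  preservesIntegral_R : ∀ (p : B12.RunParams) (k : ℕ), k < p.K → PreservesIntegral (R p k)
  /-- `R` maps integrable densities to integrable densities, `k < K` -/
  integrable_R : ∀ (p : B12.RunParams) (k : ℕ), k < p.K → ∀ ρ : Density (F.P p.K) (k + 1) (SU N),
    Integrable ρ (fieldMeasure (F.P p.K) (k + 1) (SU N)) → Integrable (R p k ρ) (fieldMeasure (F.P p.K) (k + 1) (SU N))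

/-- **Stage-5 family parameters**: the Stage-3 parameters (B4 ∕ B5 ∕ B7 ∕ k-level-B6 dictionaries), the interval constant `γ` of [Balaban1987RG1]
Thm 1 ∕ [Balaban1989LargeFieldII] Thm 1 («contained in an interval ]0, γ]»), and the residual objects. [cite: Balaban1989LargeFieldII, Thm 1 p.355 (the constant γ); Balaban1987RG1, (0.17)–(0.20) pp.255–256 (parameter dictionary)] -/
structure Stage5Params (Fam : T4Family) (N : ℕ) [NeZero N] extends Stage3Params where
  /-- the small-coupling interval constant `γ` -/
  γ : ℝ
  /-- the residual objects of the record (`Fam` = the four-torus family; inside this declaration `F` denotes the inherited flow field of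
  `Stage1Params`) -/
  res : Residual₅ Fam N

/-- **Admissibility of the Stage-5 parameters**: Stage-1 admissibility of the numeric dictionary and `0 < γ`.  NO clause constrains a residual
object (no estimate is assumed of it). [cite: Balaban1989LargeFieldII, Thm 1 p.355 («sufficiently small positive γ»); Balaban1983RegularityDecay, (1.6) p.572 (hypothesis dictionary)] -/
def Stage5Params.Admissible (θ : Stage5Params F N) : Prop :=
  θ.toStage1Params.Admissible ∧ 0 < θ.γ

/-! ## §2. The density tower, the machine, the datum, the upstream block and the record predicate -/

/-- **The density tower of the record at `θ`** along the run `p = (K, m, g₀)`: `ρ₀ = rhoZeroOfRecord K g₀ (E p)` (the Wilson start,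
[Balaban1988Convergent] Thm 1 p. 262) and `ρ_{k+1} = R_k (T_k ρ_k)` with `T_k = TrhoOfRecord K k` the renormalisation transform of record and `R_k`
the residual large-field operation — (0.2) `ρ_k = (RT)^k ρ₀`.  (Equal to the assembler's `RGMachine.dens` at the machine of the record:
`dens_machineOfRecord₅`.) [cite: Balaban1988Convergent, (0.2) p.244] -/
def densOfRecord₅ (θ : Stage5Params F N) (p : B12.RunParams) : (k : ℕ) → Density (F.P p.K) k (SU N)
  | 0 => rhoZeroOfRecord F N p.K p.g0 (θ.res.E p)
  | k + 1 => θ.res.R p k (TrhoOfRecord F N p.K k (densOfRecord₅ θ p k))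

/-- **The RG machine of the record at `θ`** (input bundle of the assembler `T4DatumAssembly.RGMachine`): the residual β-functions, normalisation,
domains, actions, expansion terms, characteristic functions and `R` verbatim; the three CLAUSE slots are the format predicates READ AT THE OBJECTS —
`Repr p k` ∕ `IndAss p k` := `ReprA` ∕ `IndA` at the forward-generated history `(g_0, …, g_k)` (`FlowStepRuns.prefixOf (genSeq βfun g₀) k`) and the
step's domain ∕ action ∕ background action ∕ expansion term; `Sect2Form p k := S218 p k ρ_k` at the density `densOfRecord₅ θ p k` — never a free
truth value. [cite: Balaban1987RG1, (0.22)–(0.24) p.256 and Thm 3 p.264; Balaban1989LargeFieldII, Thm 1 p.355 (the clauses, read at the objects)] -/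
def machineOfRecord₅ (θ : Stage5Params F N) : RGMachine F (SU N) where
  βfun := θ.res.βfun
  E := θ.res.E
  dom := θ.res.dom
  effAction := θ.res.effAction
  wilsonBG := θ.res.wilsonBG
  Ek := θ.res.Ek
  χ := θ.res.χ
  Repr := fun p k => θ.res.ReprA p k (prefixOf (genSeq θ.res.βfun p.g0) k) (θ.res.dom p k) (θ.res.effAction p k)
    (θ.res.wilsonBG p k) (θ.res.Ek p k)
  IndAss := fun p k => θ.res.IndA p k (prefixOf (genSeq θ.res.βfun p.g0) k) (θ.res.dom p k) (θ.res.effAction p k)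
    (θ.res.wilsonBG p k) (θ.res.Ek p k)
  Sect2Form := fun p k => θ.res.S218 p k (densOfRecord₅ F N θ p k)
  R := θ.res.R
  preservesIntegral_R := θ.res.preservesIntegral_R
  integrable_R := θ.res.integrable_R

/-- The assembler's density tower at the machine of the record and the averaging of record IS `densOfRecord₅` (induction on `k`, each step `rfl`).
[cite: Balaban1988Convergent, (0.2) p.244 (bookkeeping)] -/
theorem dens_machineOfRecord₅ (θ : Stage5Params F N) (p : B12.RunParams) (k : ℕ) :
    (machineOfRecord₅ F N θ).dens (avOfRecord F N) p k = densOfRecord₅ F N θ p k := by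
  induction k with
  | zero =>
    rw [RGMachine.dens_zero]
    rfl
  | succ k ih =>
    rw [RGMachine.dens_succ]
    show θ.res.R p k _ = θ.res.R p k _
    rw [ih]; rfl

/-- **The datum of record at `θ`**: the assembler's datum at the machine of the record and NODE 00's averaging of record
(`T4DatumAssembly.datumOfRecord`). [cite: Balaban1988Convergent, (0.2) p.244 and Thm 1 p.262; Balaban1987RG1, (0.3)–(0.4) p.253 and (0.17)–(0.20) pp.255–256 (the assembled dictionary)] -/
def datumOfRecord₅ (θ : Stage5Params F N) : FiniteEpsData F (SU N) :=
  datumOfRecord F N (machineOfRecord₅ F N θ)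

/-- **The upstream block of record at `θ` and the run `P`**: the N-binding over the Stage-3 carriers of record with the residual run-indexed
[B8]–[B16] carrier families. [cite: Balaban1984PropagatorsII, pp.223–250; Balaban1985Averaging, Props. 1–10 pp.26–50; Balaban1983RegularityDecay, (1.1)–(1.7) pp.572–573; Balaban1984PropagatorsI, Props. 1.1–1.2 pp.33–36 (the Stage-3 carriers of record)] -/
def upOfRecord₅ (θ : Stage5Params F N) (P : B12.RunParams) : Upstream :=
  Upstream.ofPrintedAllXPN (carriers₃ θ.toStage3Params (θ.res.X P)) (θ.res.Y P) (θ.res.Z P) (θ.res.V P) (θ.res.W P)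

/-- **«(D, w) is the record, Stage 5»** — NODE 00's RECORD PREDICATE at the assembler stage (shape `YMDAG.UVSplit.RecordPred N` up to the order of
`F`, `N`): for SOME admissible Stage-5 parameters `θ`, the datum IS the assembled datum of record at `θ`, the world's construction IS the datum's,
its interval constant is `θ.γ`, its block size is Bałaban's `L`, and at every run its upstream block is the binding of record at `θ`.
[cite: Balaban1988Convergent, (0.2) p.244; Balaban1989LargeFieldII, Thm 1 + (0.1) pp.355–356; Balaban1987RG1, (0.17)–(0.20) pp.255–256 (objects of record, Stage 5 dictionary)] -/
def IsRecordOfRecord₅ (D : FiniteEpsData F (SU N)) (w : WorldP) : Prop :=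
  ∃ θ : Stage5Params F N, θ.Admissible ∧ D = datumOfRecord₅ F N θ ∧ w.C = D.C ∧ w.γ = θ.γ ∧ w.L = (θ.L : ℝ) ∧
    ∀ P : B12.RunParams, w.up P = upOfRecord₅ F N θ P

/-! ## §3. What the record predicate forces (kernel bookkeeping; no estimate) -/

section Consequences

variable {F N}
variable {D : FiniteEpsData F (SU N)} {w : WorldP}

/-- A Stage-5 record's world is a world of record, Stage 3 (hence Stages 2, 1). [cite: Balaban1984PropagatorsII, pp.223–250 (bookkeeping)] -/
theorem isWorldOfRecord₃_of_isRecordOfRecord₅ (h : IsRecordOfRecord₅ F N D w) : IsWorldOfRecord₃ w := by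
  obtain ⟨θ, hθ, -, -, -, -, hup⟩ := h
  exact ⟨θ.toStage3Params, hθ.1, fun P => ⟨θ.res.X P, θ.res.Y P, θ.res.Z P, θ.res.V P, θ.res.W P, hup P⟩⟩

/-- A Stage-5 record's datum is a datum of record, Stage 0 (its averaging IS the averaging of record). [cite: Balaban1987RG1, (0.3)–(0.4) p.253 (bookkeeping)] -/
theorem isDatumOfRecord₀_of_isRecordOfRecord₅ (h : IsRecordOfRecord₅ F N D w) : IsDatumOfRecord₀ F N D := by
  obtain ⟨θ, -, rfl, -⟩ := h
  exact isDatumOfRecord₀_datumOfRecord F N _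

/-- Binding half, clause 1: the world's construction IS the datum's. [cite: Balaban1989LargeFieldII, Thm 1 p.355 (bookkeeping)] -/
theorem construction_eq_of_isRecordOfRecord₅ (h : IsRecordOfRecord₅ F N D w) : w.C = D.C := h.choose_spec.2.2.1

/-- Binding half, clause 2: the interval constant is positive. [cite: Balaban1989LargeFieldII, Thm 1 p.355 (bookkeeping)] -/
theorem gamma_pos_of_isRecordOfRecord₅ (h : IsRecordOfRecord₅ F N D w) : 0 < w.γ := by
  obtain ⟨θ, hθ, -, -, hγ, -⟩ := h
  rw [hγ]; exact hθ.2

/-- The construction of a Stage-5 record is the ASSEMBLED construction at the machine of the record and the averaging of record.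
[cite: Balaban1988Convergent, (0.2) p.244 (bookkeeping)] -/
theorem construction_eq_assembled (h : IsRecordOfRecord₅ F N D w) :
    ∃ θ : Stage5Params F N, θ.Admissible ∧ w.γ = θ.γ ∧
      w.C = (machineOfRecord₅ F N θ).construction (avOfRecord F N) := by
  obtain ⟨θ, hθ, rfl, hC, hγ, -, -⟩ := h
  exact ⟨θ, hθ, hγ, hC⟩

/-- At a Stage-5 record's parameters, the §2-FORM CLAUSE of the assembled construction at run `p`, step `k` IS the format predicate `S218` at the
density of record `ρ_k` (`Iff.rfl`) — so `B16.Thm1Printed (datumOfRecord₅ θ).C` speaks about the determined densities, not a free truth value.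
[cite: Balaban1989LargeFieldII, Thm 1 p.355 (bookkeeping)] -/
theorem sect2Form_datumOfRecord₅_iff (θ : Stage5Params F N) (p : B12.RunParams) (k : ℕ) :
    ((datumOfRecord₅ F N θ).C p).Sect2Form k ↔ θ.res.S218 p k (densOfRecord₅ F N θ p k) := Iff.rfl

/-- The densities of the assembled construction at `θ` ARE the density tower of record (`dens_machineOfRecord₅`). [cite: Balaban1988Convergent, (0.2) p.244 (bookkeeping)] -/
theorem rho_datumOfRecord₅ (θ : Stage5Params F N) (p : B12.RunParams) (k : ℕ) :
    ((datumOfRecord₅ F N θ).C p).ρ k = densOfRecord₅ F N θ p k :=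
  dens_machineOfRecord₅ F N θ p k

/-- The flow of the assembled construction at `θ` is generated FORWARD from the bare coupling by (0.18)∕(0.20) with the residual β-functions
(`FlowStepRuns.genFlow`; `rfl`). [cite: Balaban1987RG1, (0.17)–(0.20) pp.255–256 (bookkeeping)] -/
theorem flow_datumOfRecord₅ (θ : Stage5Params F N) (p : B12.RunParams) :
    ((datumOfRecord₅ F N θ).C p).flow = genFlow θ.res.βfun p.g0 := rfl

/-- **Binding half, clause 3 — GUARDED (0.20)**: along every run of a Stage-5 record whose couplings stay in `]0, w.γ]`, the flow satisfies
(0.20) (`T4DatumAssembly.RGMachine.satisfiesRG_construction`: in-interval forward-generated runs never halt) — NO input.  This is all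
`DagBinding.endStatementBPrinted_of_nodesP_interval` consumes of the `rgFlow` leaf. [cite: Balaban1987RG1, (0.20) p.256] -/
theorem rgFlow_of_smallCouplings (h : IsRecordOfRecord₅ F N D w) (P : B12.RunParams)
    (hsc : (leavesP w P).smallCouplings) : (leavesP w P).rgFlow := by
  obtain ⟨θ, -, -, hC⟩ := construction_eq_assembled h
  show (w.C P).flow.SatisfiesRG P.K
  have hsc' : (w.C P).flow.InInterval w.γ P.K := hsc
  rw [hC] at hsc' ⊢
  exact RGMachine.satisfiesRG_construction _ _ P hsc'

/-- **Binding half, clause 3 — UNGUARDED (0.20)** holds at a Stage-5 record IFF the residual β-functions never overshoot along the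
forward-generated runs (`RGMachine.satisfiesRG_genFlow_iff`); here the sufficient direction at the record. [cite: Balaban1987RG1, (0.18)–(0.20) pp.255–256] -/
theorem rgFlow_of_noOvershoot (h : IsRecordOfRecord₅ F N D w)
    (hno : ∀ θ : Stage5Params F N, θ.Admissible → ∀ (p : B12.RunParams) (k : ℕ), k < p.K →
      θ.res.βfun k (prefixOf (genSeq θ.res.βfun p.g0) k) ≤ 1 / (genSeq θ.res.βfun p.g0 k) ^ 2)
    (P : B12.RunParams) : (leavesP w P).rgFlow := by
  obtain ⟨θ, hθ, -, hC⟩ := construction_eq_assembled h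
  exact RGMachine.rgFlow_of_noOvershoot _ _ w hC (hno θ hθ) P

/-- **The β-window binder at a Stage-5 record from BOX BOUNDS of the residual β-functions** (`b ≤ β ≤ β⁺` on `]0, γ₀]^{k+1}`):
`DagBinding.BetaBoundsInInterval w.C.toB12 γ₀ b β⁺` (`RGMachine.betaBoundsInInterval_construction`).  Upper half printed ([Balaban1987RG1] p. 264),
lower half unprinted (T09.F); both DISPLAYED, neither assumed. [cite: Balaban1987RG1, (1.22) p.264] -/
theorem betaBoundsInInterval_of_boxBounds (h : IsRecordOfRecord₅ F N D w) {γ₀ b βup : ℝ}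
    (hbox : ∀ θ : Stage5Params F N, θ.Admissible → BetaLowerH b γ₀ θ.res.βfun ∧ BetaUpperH βup γ₀ θ.res.βfun) :
    BetaBoundsInInterval w.C.toB12 γ₀ b βup := by
  obtain ⟨θ, hθ, -, hC⟩ := construction_eq_assembled h
  rw [hC]
  exact RGMachine.betaBoundsInInterval_construction _ _ (hbox θ hθ).1 (hbox θ hθ).2

/-- **The END headline with the GUARDED (0.20) leaf** — `DagBinding.endStatementBPrinted_of_nodesP_interval` VERBATIM except that the `rgFlow`
hypothesis is asked only along in-interval runs (`smallCouplings → rgFlow`), which is all its proof uses (the `hrg P` call sits under `intro hsc`).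
Bookkeeping twin for worlds whose flow is forward-generated (there the guarded leaf is a theorem, `rgFlow_of_smallCouplings`). [cite: Balaban1989LargeFieldII, Thm 1 p.355 + p.391] -/
theorem endStatementBPrinted_of_nodesP_interval_guarded (w : WorldP) (hγ : 0 < w.γ) {γ₀ : ℝ} (hγ₀ : w.γ ≤ γ₀)
    (hnodes : ∀ P, Nodes (leavesP w P)) (hrg : ∀ P, (leavesP w P).smallCouplings → (leavesP w P).rgFlow)
    (hβ : BetaBoundsInInterval w.C.toB12 γ₀ w.b w.βup) : B16.EndStatementBPrinted w.C := by
  refine endStatementBPrinted_of_worldsP w hγ fun P => uvStability_of_nodes (leavesP w P) (hnodes P) ?_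
  intro hsc
  obtain ⟨hlo, hhi⟩ := alongRun_of_inInterval w.C.toB12 hβ hγ₀ P hsc
  exact flowIneq26_of_alongRun (w.withConsts 0 0) P (hrg P hsc) hhi hlo fun k hk => (hsc k hk).1

/-- **At a Stage-5 record the END headline needs NO `rgFlow` binder**: the thirteen nodes at every run + the β-window binder on `]0, γ₀] ⊇ ]0, w.γ]`
give `B16.EndStatementBPrinted D.C` — (0.20) along in-interval runs and `0 < γ`, `w.C = D.C` are supplied by the record (`rgFlow_of_smallCouplings`,
`gamma_pos_of_isRecordOfRecord₅`, `construction_eq_of_isRecordOfRecord₅`).  The shape of N24's glue at the record. [cite: Balaban1989LargeFieldII, Thm 1 p.355 + p.391] -/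
theorem endStatementBPrinted_of_isRecordOfRecord₅_of_nodes (h : IsRecordOfRecord₅ F N D w) {γ₀ : ℝ} (hγ₀ : w.γ ≤ γ₀)
    (hnodes : ∀ P, Nodes (leavesP w P)) (hβ : BetaBoundsInInterval w.C.toB12 γ₀ w.b w.βup) :
    B16.EndStatementBPrinted D.C := by
  rw [← construction_eq_of_isRecordOfRecord₅ h]
  exact endStatementBPrinted_of_nodesP_interval_guarded w (gamma_pos_of_isRecordOfRecord₅ h) hγ₀ hnodes
    (rgFlow_of_smallCouplings h) hβ

/-- N01 · `Dag.B4_main` at every run of every Stage-5 record (through Stage 3). [cite: Balaban1983RegularityDecay, Theorem p.573 (kernel version of the lit-balaban r01 lineage)] -/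
theorem b4_main_of_isRecordOfRecord₅ (h : IsRecordOfRecord₅ F N D w) (P : B12.RunParams) : Dag.B4_main (leavesP w P) :=
  b4_main_of_isWorldOfRecord₃ w (isWorldOfRecord₃_of_isRecordOfRecord₅ h) P

/-- N02 · `Dag.B5_main` at every run of every Stage-5 record. [cite: Balaban1984PropagatorsI, Props. 1.1–1.2 pp.33–36 (kernel versions of the lit-balaban lineages)] -/
theorem b5_main_of_isRecordOfRecord₅ (h : IsRecordOfRecord₅ F N D w) (P : B12.RunParams) : Dag.B5_main (leavesP w P) :=
  b5_main_of_isWorldOfRecord₃ w (isWorldOfRecord₃_of_isRecordOfRecord₅ h) P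

/-- N04 · `Dag.B7_main` at every run of every Stage-5 record. [cite: Balaban1985Averaging, Props. 1–10 pp.26–50 (kernel version of the lit-balaban lineage)] -/
theorem b7_main_of_isRecordOfRecord₅ (h : IsRecordOfRecord₅ F N D w) (P : B12.RunParams) : Dag.B7_main (leavesP w P) :=
  b7_main_of_isWorldOfRecord₃ w (isWorldOfRecord₃_of_isRecordOfRecord₅ h) P

/-- N03 · `Dag.B6_main` at every run of every Stage-5 record MODULO EXACTLY the Prop. 2.6 census (`Carriers3Leaf`). [cite: Balaban1984PropagatorsII, Lemma 2.1 – Cor. 2.8 pp.234–249 (the stated block at the objects of record)] -/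
theorem b6_main_of_isRecordOfRecord₅_of_prop26
    (h26 : ∀ θ : Stage3Params, θ.toStage1Params.Admissible →
      B6.Prop26Printed (fun i : KIdx θ.d₆ θ.ℓ₆ θ.hd' θ.hL' θ.b₀ θ.b₁ => kGeoG i) (fun i => kG i))
    (h : IsRecordOfRecord₅ F N D w) (P : B12.RunParams) : Dag.B6_main (leavesP w P) :=
  b6_main_of_isWorldOfRecord₃_of_prop26 h26 w (isWorldOfRecord₃_of_isRecordOfRecord₅ h) P

/-- N23 · binder B1 at every Stage-5 record: the datum is printed-averaged. [cite: Balaban1987RG1, (0.4) p.253] -/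
theorem isPrintedAveraged_of_isRecordOfRecord₅ (h : IsRecordOfRecord₅ F N D w) : D.IsPrintedAveraged :=
  isPrintedAveraged_of_isDatumOfRecord₀ F N D (isDatumOfRecord₀_of_isRecordOfRecord₅ h)

end Consequences

/-- **The constant-binding records**: for admissible `θ`, the assembled datum and ANY world re-bound to its construction, `θ.γ`, `θ.L` and the
upstream block of record form a Stage-5 record (the shape YM-PLAN §2a posits: `w₀.up = fun P => …`, `w₀.C = D₀.C`). [cite: Balaban1989LargeFieldII, Thm 1 + (0.1) pp.355–356 (objects of record, bookkeeping)] -/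
theorem isRecordOfRecord₅_of_eq (θ : Stage5Params F N) (hθ : θ.Admissible) (w : WorldP)
    (hC : w.C = (datumOfRecord₅ F N θ).C) (hγ : w.γ = θ.γ) (hL : w.L = (θ.L : ℝ))
    (hup : ∀ P, w.up P = upOfRecord₅ F N θ P) : IsRecordOfRecord₅ F N (datumOfRecord₅ F N θ) w :=
  ⟨θ, hθ, rfl, hC, hγ, hL, hup⟩

end Literature.MathematicalPhysics.QuantumFieldTheory.Balaban1983to89.Node00

end
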